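import Mathlib
import Literature.Computability.AlgebraicComplexity.GlynnMultilinearSigmaPiSigma
import Literature.Computability.AlgebraicComplexity.PermanentIrreducible
import Literature.Barriers.ValiantsHypothesis.MonotoneGapPermanentLower
import Summits.ValiantsHypothesis.ValiantsHypothesis.Theorems.RigidityForcesSymmetryRankRigidMinimalReprBlockDefs
import Summits.ValiantsHypothesis.ValiantsHypothesis.Theorems.RigidityForcesSymmetryRankRigidMinimalReprLaplaceDefs
import Summits.ValiantsHypothesis.ValiantsHypothesis.Theorems.RigidityForcesSymmetryRankRigidMinimalReprLaplaceFourOptimal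
import Summits.ValiantsHypothesis.ValiantsHypothesis.Theses.PolyaContinued
import Summits.ValiantsHypothesis.ValiantsHypothesis.Theses.RigidityForcesSymmetry
import HarnessLib

/-!
# Sketch (val-idea-10 g4, line `left_ideal_rung`): the LEFT-IDEAL Laplace law ⇐ `LaplaceOptimal`

Director-valiant R234 (a), 2026-08-28: ONE bounded zero-kit pass; banked rung material under the HELD crux
`CoverDecancellation` (stmt-ValiantsHypothesis-17819, calibrated ≥ summit) — NOT distance-to-summit; no item, no
route, no Theorems file. One-writer: this is a SEPARATE file from val-idea-18's `Lines/left_torus_rung.lean`, whose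
orphaned M-stub `stub_leftTorusFixed_of_laplaceOptimal` it closes (in a STRONGER, ideal-theoretic form); the four
definitions `rowDeg`, `IsRowWeightVector`, `IsTwoFactorDecomp`, `LeftTorusFixedLaplaceRigidity` are restated
VERBATIM so that the closed statement is token-identical to the stub.

## The law (v1.1)

`LeftIdealLaplaceRigidity n`: for `0 < k < n`, if `per_n = ∑_{t < w} p_t · q_t` with every `p_t` a HOMOGENEOUS degree-`k`
WEIGHT VECTOR OF THE ROW TORUS (all its monomials share one row-degree vector) and the cofactors `q_t` ARBITRARY, then
`w ≥ C(n,k)`.  Equivalently: `per_n` lies in no ideal generated by fewer than `C(n,k)` row-equivariant `k`-forms.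
`MixedLeftIdealLaw n` (generators of mixed degrees `k_t`): `∑_t k_t! (n - k_t)! ≥ n!`, i.e. `∑_t 1/C(n,k_t) ≥ 1`.

* `mixedLeftIdealLaw_of_laplaceOptimal : LaplaceOptimal n → MixedLeftIdealLaw n` and
  `leftIdeal_of_laplaceOptimal : LaplaceOptimal n → LeftIdealLaplaceRigidity n` (sorry-free).  Mechanism: only the
  indices `t` whose `p_t` is ROW-TYPED by a `k_t`-set `I_t` (degree 1 in the rows of `I_t`, 0 elsewhere) can meet a
  one-variable-per-row monomial `m_v = ∏_i X_{i, v i}` (`coeff_graphMonomial_mul_eq_zero_of_not_rowTyped`); for those,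
  ONE-SIDED unique factorisation of `m_v` across `(I_t, I_tᶜ)` (`coeff_graphMonomial_mul_of_isRowTyped`, no hypothesis
  on `q`) gives `coeff_{m_v}(p_t q_t) = coeff_{m_v | I_t}(p_t) · coeff_{m_v | I_tᶜ}(q_t)` — a split-rank-one term with
  `S_t = I_t`; summing, `∑_t u_t(v) w_t(v) = coeff_{m_v}(per_n) = [v injective]`, and `LaplaceOptimal n` yields the weights.
* CONVERSE DICTIONARY `laplaceOptimal_of_mixedLeftIdealLaw : MixedLeftIdealLaw n → LaplaceOptimal n` (§4: lift each
  pattern factor to a row-typed polynomial `liftGen`; `∑_t P_t Q_t = per_n` coefficientwise), hence the EQUIVALENCE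
  `laplaceOptimal_iff_mixedLeftIdealLaw : LaplaceOptimal n ↔ MixedLeftIdealLaw n` — Laplace optimality of the
  permutation pattern (stmt-24813's object) IS an ideal-membership law for `per_n`
  (`laplaceOptimalFive_iff_mixedLeftIdealLaw_five : LaplaceOptimalFive ↔ MixedLeftIdealLaw 5`).
* `stub_leftTorusFixed_of_laplaceOptimal` — val-idea-18's stub, now a theorem (corollary).
* `(4,k)` UNCONDITIONAL from the landed `laplaceOptimal_four` (✓ p597028): `mixedLeftIdealLaw_four`, `leftIdeal_four`;
  `per₄ ∉ (p₁, …, p₅)` for any five row-equivariant quadrics `p_i` (`perFour_not_mem_span_five_rowEquivariant_quadrics`);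
  in particular no row-homogeneous (2,2)-decomposition of `per₄` of width 5 (`leftTorusFixedRungFourTwo`, val-idea-18's
  statement with the hypothesis `LaplaceOptimal 4` discharged).  CONTRAST (cited, not re-proved here):
  `det₄ = u₁₂u₃₄ − u₁₃u₂₄ + u₁₄u₂₃` with `u_ij = ∑_J det A_{{i,j},J}` row-equivariant quadrics [arXiv:2509.06294, Thm 3]
  ⇒ `det₄ ∈ (u₁₂, u₁₃, u₁₄)`: per/det SEPARATE at the row-equivariant-ideal level at n = 4 (6 vs ≤ 3).
* `(5,k)` BY NAME from stmt-24813 `Theses.RigidityForcesSymmetry.LaplaceOptimalFive` (`leftIdeal_five`, rungs (5,2), (5,3)).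
* Placement: `StrengthTwoPerFour` (stmt-25160, open, GATED) ⇒ the (4,2) left-ideal rung (`…_of_strengthTwoPerFour`,
  via homogenisation of the cofactors); the rung is therefore BELOW 25160 and incomparable with 27571.

HONEST FRAMING: support-rung material below `StrengthTwoPerFour`; nothing of `CoverDecancellation` (HELD, ≥ summit) or
VP ≠ VNP is asserted or moved; an S⁺ of CoverDecancellation admitting induction on cover size was NOT found (g2/g3
found-nothing-with-map stands).  Zero kit.
-/

set_option autoImplicit false
set_option linter.dupNamespace false

namespace Summit.ValiantsHypothesis.ValiantsHypothesis.Cruxes.CoverDecancellation.LeftIdealRung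

open MvPolynomial Finset
open Literature.Computability.AlgebraicComplexity
open Summit.ValiantsHypothesis.ValiantsHypothesis.Theorems.RigidityForcesSymmetryRankRigidMinimalRepr
  (LaplaceOptimal laplaceOptimal_four graphMonomialOn graphMonomialOn_apply graphMonomialOn_add_compl
    graphMonomialOn_congr)

noncomputable section

/-! ### §0 Definitions restated VERBATIM from `Lines/left_torus_rung.lean` (val-idea-18; workfiles are not importable) -/

/-- row-degree vector of a monomial (verbatim `rowDeg` of `Lines/laplace_rigidity.lean` l.500). -/
def rowDeg {n : ℕ} (m : (Fin n × Fin n) →₀ ℕ) : Fin n → ℕ := fun i => ∑ j, m (i, j)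

/-- `f` is a weight vector of the LEFT (row) torus `(ℂˣ)ⁿ`: all monomials share the row-degree vector
(compare `IsTorusWeightVector` ibid., which also fixes the column degrees). Vacuous for `f = 0`. -/
def IsRowWeightVector {n : ℕ} (f : MvPolynomial (Fin n × Fin n) ℂ) : Prop :=
  ∀ m ∈ f.support, ∀ m' ∈ f.support, rowDeg m = rowDeg m'

/-- verbatim copy of `…Cruxes.CoverDecancellation.LaplaceRigidity.IsTwoFactorDecomp` (workfiles are not importable). -/
def IsTwoFactorDecomp (n k w : ℕ) (p q : Fin w → MvPolynomial (Fin n × Fin n) ℂ) : Prop :=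
  (∀ i, (p i).IsHomogeneous k) ∧ (∀ i, (q i).IsHomogeneous (n - k)) ∧
    Literature.Computability.AlgebraicComplexity.perPoly (Fin n) ℂ = ∑ i, p i * q i

/-- **R2½ — left-torus-fixed Laplace rigidity at `n`**: every (k, n−k) two-factor decomposition of `per_n` whose
factors are ROW weight vectors has width `≥ C(n,k)`. -/
def LeftTorusFixedLaplaceRigidity (n : ℕ) : Prop :=
  ∀ k w : ℕ, 0 < k → k < n → ∀ p q : Fin w → MvPolynomial (Fin n × Fin n) ℂ,
    (∀ i, IsRowWeightVector (p i)) → (∀ i, IsRowWeightVector (q i)) →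
      IsTwoFactorDecomp n k w p q → n.choose k ≤ w

/-! ### §1 The left-ideal law -/

/-- **LEFT-IDEAL Laplace rigidity at `n`** (this file's strengthening of R2½): if `per_n = ∑_{t<w} p_t q_t` with every
`p_t` a homogeneous degree-`k` weight vector of the ROW torus and the `q_t` ARBITRARY, then `w ≥ C(n,k)` — i.e. `per_n`
lies in no ideal generated by fewer than `C(n,k)` row-equivariant `k`-forms (`0 < k < n`). -/
def LeftIdealLaplaceRigidity (n : ℕ) : Prop :=
  ∀ k w : ℕ, 0 < k → k < n → ∀ p q : Fin w → MvPolynomial (Fin n × Fin n) ℂ,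
    (∀ t, (p t).IsHomogeneous k) → (∀ t, IsRowWeightVector (p t)) →
      perPoly (Fin n) ℂ = ∑ t, p t * q t → n.choose k ≤ w

variable {n : ℕ}

/-- `P` is ROW-TYPED by `I`: every monomial of `P` has degree `1` in each row of `I` and `0` in every other row. -/
def IsRowTyped (I : Finset (Fin n)) (P : MvPolynomial (Fin n × Fin n) ℂ) : Prop :=
  ∀ d ∈ P.support, ∀ i : Fin n, rowCount d i = if i ∈ I then 1 else 0

/-- In a splitting `e + f = graphMonomial τ`, the summand `e` vanishes off the graph of `τ`. [bookkeeping] -/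
private theorem apply_eq_zero_of_add_eq_graphMonomial {e f : (Fin n × Fin n) →₀ ℕ} {τ : Fin n → Fin n}
    (h : e + f = graphMonomial τ) (i j : Fin n) (hij : τ i ≠ j) : e (i, j) = 0 := by
  have h1 := DFunLike.congr_fun h (i, j)
  rw [Finsupp.add_apply, graphMonomial_apply, if_neg hij] at h1
  omega

/-- … and its entry on the graph is at most `1`. [bookkeeping] -/
private theorem apply_le_one_of_add_eq_graphMonomial {e f : (Fin n × Fin n) →₀ ℕ} {τ : Fin n → Fin n}
    (h : e + f = graphMonomial τ) (i : Fin n) : e (i, τ i) ≤ 1 := by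
  have h1 := DFunLike.congr_fun h (i, τ i)
  rw [Finsupp.add_apply, graphMonomial_apply, if_pos rfl] at h1
  omega

/-- … so its row counts are its graph entries. [bookkeeping] -/
private theorem rowCount_eq_of_add_eq_graphMonomial {e f : (Fin n × Fin n) →₀ ℕ} {τ : Fin n → Fin n}
    (h : e + f = graphMonomial τ) (i : Fin n) : rowCount e i = e (i, τ i) := by
  classical
  unfold rowCount
  rw [Finset.sum_eq_single (τ i)]
  · intro c _ hc
    exact apply_eq_zero_of_add_eq_graphMonomial h i c (Ne.symm hc)
  · intro hc
    exact absurd (Finset.mem_univ _) hc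

/-- **Unique factorisation, one-sided.**  If `P` is row-typed by `I` (no hypothesis on `Q`), the coefficient in
`P · Q` of the one-variable-per-row monomial `∏_i X_{i, τ i}` is `coeff_{rows in I}(P) · coeff_{rows off I}(Q)`:
in any splitting `e + f` with `e ∈ supp P`, row-typing forces `e =` the `I`-part, hence `f =` the `Iᶜ`-part. -/
theorem coeff_graphMonomial_mul_of_isRowTyped {I : Finset (Fin n)} {P Q : MvPolynomial (Fin n × Fin n) ℂ}
    (hP : IsRowTyped I P) (τ : Fin n → Fin n) :
    coeff (graphMonomial τ) (P * Q) = coeff (graphMonomialOn I τ) P * coeff (graphMonomialOn Iᶜ τ) Q := by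
  classical
  rw [coeff_mul, Finset.sum_eq_single (graphMonomialOn I τ, graphMonomialOn Iᶜ τ)]
  · rintro ⟨e, f⟩ hef hne
    by_contra h
    have he : e ∈ P.support := mem_support_iff.2 (left_ne_zero_of_mul h)
    have hsplit : e + f = graphMonomial τ := Finset.HasAntidiagonal.mem_antidiagonal.1 hef
    have heI : e = graphMonomialOn I τ := by
      ext ⟨i, j⟩
      rw [graphMonomialOn_apply]
      by_cases hij : τ i = j
      · subst hij
        have h1 := hP e he i
        rw [rowCount_eq_of_add_eq_graphMonomial hsplit i] at h1
        rw [h1]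
        by_cases hi : i ∈ I
        · rw [if_pos hi, if_pos ⟨hi, rfl⟩]
        · rw [if_neg hi, if_neg fun h' => hi h'.1]
      · rw [apply_eq_zero_of_add_eq_graphMonomial hsplit i j hij, if_neg fun h' => hij h'.2]
    have hfI : f = graphMonomialOn Iᶜ τ := by
      have h1 : graphMonomialOn I τ + f = graphMonomialOn I τ + graphMonomialOn Iᶜ τ := by
        rw [graphMonomialOn_add_compl, ← heI]; exact hsplit
      exact add_left_cancel h1
    exact hne (Prod.ext heI hfI)
  · intro h
    exact absurd (Finset.HasAntidiagonal.mem_antidiagonal.2 (graphMonomialOn_add_compl I τ)) h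

/-- degree of a support monomial of a homogeneous polynomial. [bookkeeping] -/
private theorem degree_eq_of_isHomogeneous {k : ℕ} {φ : MvPolynomial (Fin n × Fin n) ℂ} {d : (Fin n × Fin n) →₀ ℕ}
    (h : φ.IsHomogeneous k) (hd : d ∈ φ.support) : d.degree = k := by
  by_contra hne
  exact (mem_support_iff.1 hd) (h.coeff_eq_zero hne)

/-- the degree of a monomial is the sum of its row counts. [bookkeeping] -/
private theorem degree_eq_sum_rowCount (d : (Fin n × Fin n) →₀ ℕ) : d.degree = ∑ i, rowCount d i := by
  unfold rowCount
  rw [Finsupp.degree_eq_sum, Fintype.sum_prod_type]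

/-- **Untyped row weight vectors do not meet multilinear monomials.**  If `P` is a homogeneous degree-`k` row weight
vector that is NOT row-typed by any `k`-set, then no one-variable-per-row monomial occurs in `P · Q` (any `Q`): a
splitting `e + f = ∏ X_{i,τ i}` with `e ∈ supp P` forces `e` to have 0/1 row counts, summing to `deg e = k`, and the
weight-vector property transports these row counts to all of `supp P`. -/
theorem coeff_graphMonomial_mul_eq_zero_of_not_rowTyped {k : ℕ} {P Q : MvPolynomial (Fin n × Fin n) ℂ}
    (hw : IsRowWeightVector P) (hh : P.IsHomogeneous k) (hno : ¬ ∃ I : Finset (Fin n), I.card = k ∧ IsRowTyped I P)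
    (τ : Fin n → Fin n) : coeff (graphMonomial τ) (P * Q) = 0 := by
  classical
  by_contra hne
  rw [coeff_mul] at hne
  obtain ⟨⟨e, f⟩, hef, hprod⟩ := Finset.exists_ne_zero_of_sum_ne_zero hne
  have he : e ∈ P.support := mem_support_iff.2 (left_ne_zero_of_mul hprod)
  have hsplit : e + f = graphMonomial τ := Finset.HasAntidiagonal.mem_antidiagonal.1 hef
  let I : Finset (Fin n) := Finset.univ.filter fun i => e (i, τ i) = 1
  have hrow_e : ∀ i, rowCount e i = if i ∈ I then 1 else 0 := fun i => by
    rw [rowCount_eq_of_add_eq_graphMonomial hsplit i]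
    by_cases h1 : e (i, τ i) = 1
    · rw [if_pos (show i ∈ I from Finset.mem_filter.2 ⟨Finset.mem_univ _, h1⟩), h1]
    · have h0 : e (i, τ i) = 0 := by
        have := apply_le_one_of_add_eq_graphMonomial hsplit i
        omega
      rw [h0, if_neg (show i ∉ I from fun h' => h1 (Finset.mem_filter.1 h').2)]
  have htyped : IsRowTyped I P := fun d hd i => by
    have h1 : rowDeg d = rowDeg e := hw d hd e he
    have h2 : rowCount d i = rowCount e i := congrFun h1 i
    rw [h2]
    exact hrow_e i
  have hcard : I.card = k := by
    have h1 := degree_eq_sum_rowCount e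
    rw [degree_eq_of_isHomogeneous hh he] at h1
    simp_rw [hrow_e] at h1
    rw [Finset.sum_boole, Nat.cast_id] at h1
    rw [h1]
    congr 1
    ext i
    simp
  exact hno ⟨I, hcard, htyped⟩

/-- `[v bijective] = [v injective]` for self-maps of `Fin n`. [bookkeeping] -/
private theorem coeff_graphMonomial_perPoly_eq_injective (v : Fin n → Fin n) :
    coeff (graphMonomial v) (perPoly (Fin n) ℂ) = if Function.Injective v then 1 else 0 := by
  rw [coeff_graphMonomial_perPoly]
  by_cases hv : Function.Injective v
  · rw [if_pos hv, if_pos (Finite.injective_iff_bijective.1 hv)]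
  · rw [if_neg hv, if_neg fun hb => hv hb.1]

/-- **MIXED LEFT-IDEAL LAW at `n`** (generators of mixed degrees): in any expression `per_n = ∑_{t<w} p_t q_t` with
every `p_t` a homogeneous (degree `k_t`) weight vector of the ROW torus and the `q_t` ARBITRARY, the Laplace weights
satisfy `∑_t k_t! (n - k_t)! ≥ n!`, i.e. `∑_t 1 / C(n, k_t) ≥ 1`.  By `laplaceOptimal_iff_mixedLeftIdealLaw` below this
is EXACTLY `LaplaceOptimal n` read in ideal-theoretic currency. -/
def MixedLeftIdealLaw (n : ℕ) : Prop :=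
  ∀ (w : ℕ) (kd : Fin w → ℕ) (p q : Fin w → MvPolynomial (Fin n × Fin n) ℂ),
    (∀ t, (p t).IsHomogeneous (kd t)) → (∀ t, IsRowWeightVector (p t)) →
      perPoly (Fin n) ℂ = ∑ t, p t * q t → n.factorial ≤ ∑ t, (kd t).factorial * (n - kd t).factorial

/-- **MAIN (forward dictionary): `LaplaceOptimal n ⇒ MixedLeftIdealLaw n`.**  Index `t` with `p_t` row-typed by
`I_t` ↦ the split-rank-one term `S_t := I_t`, `u_t(v) := coeff_{m_v|I_t}(p_t)`, `w_t(v) := coeff_{m_v|I_tᶜ}(q_t)`;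
untyped indices are dropped (they meet no `m_v`); coefficient extraction at the graph monomials `m_v` turns
`per_n = ∑ p_t q_t` into the pattern identity `∑_{t typed} u_t w_t = [v injective]`, and `LaplaceOptimal n` reads
`n! ≤ ∑_{t typed} k_t! (n-k_t)!`. -/
theorem mixedLeftIdealLaw_of_laplaceOptimal (n : ℕ) (hL : LaplaceOptimal n) : MixedLeftIdealLaw n := by
  classical
  intro w kd p q hp hw hper
  -- row types; typed indices
  let good : Fin w → Prop := fun t => ∃ I : Finset (Fin n), I.card = kd t ∧ IsRowTyped I (p t)
  let T : Finset (Fin w) := Finset.univ.filter fun t => good t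
  let I : Fin w → Finset (Fin n) := fun t => if h : good t then h.choose else ∅
  have hIgood : ∀ t, good t → (I t).card = kd t ∧ IsRowTyped (I t) (p t) := fun t h => by
    simp only [I, dif_pos h]; exact h.choose_spec
  have hT : ∀ t, t ∈ T ↔ good t := fun t => by simp [T]
  -- the split-rank-one terms
  let uu : Fin w → (Fin n → Fin n) → ℂ := fun t v => coeff (graphMonomialOn (I t) v) (p t)
  let ww : Fin w → (Fin n → Fin n) → ℂ := fun t v => coeff (graphMonomialOn (I t)ᶜ v) (q t)
  have hloc_u : ∀ t, ∀ v v' : Fin n → Fin n, (∀ i ∈ I t, v i = v' i) → uu t v = uu t v' := fun t v v' h => by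
    simp only [uu, graphMonomialOn_congr h]
  have hloc_w : ∀ t, ∀ v v' : Fin n → Fin n, (∀ i, i ∉ I t → v i = v' i) → ww t v = ww t v' :=
    fun t v v' h => by
      simp only [ww, graphMonomialOn_congr (I := (I t)ᶜ) (fun i hi => h i (Finset.mem_compl.1 hi))]
  have hsum : ∀ v : Fin n → Fin n, (∑ t ∈ T, uu t v * ww t v) = if Function.Injective v then 1 else 0 :=
    fun v => by
      have h1 : ∀ t ∈ T, uu t v * ww t v = coeff (graphMonomial v) (p t * q t) := fun t ht =>
        (coeff_graphMonomial_mul_of_isRowTyped (hIgood t ((hT t).1 ht)).2 v).symm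
      have h2 : (∑ t ∈ T, coeff (graphMonomial v) (p t * q t)) = ∑ t, coeff (graphMonomial v) (p t * q t) :=
        Finset.sum_subset (Finset.subset_univ _) fun t _ ht =>
          coeff_graphMonomial_mul_eq_zero_of_not_rowTyped (hw t) (hp t) (fun h => ht ((hT t).2 h)) v
      rw [Finset.sum_congr rfl h1, h2, ← coeff_sum, ← hper]
      exact coeff_graphMonomial_perPoly_eq_injective v
  have hmain := hL w T I uu ww hloc_u hloc_w hsum
  calc n.factorial ≤ ∑ t ∈ T, (I t).card.factorial * (n - (I t).card).factorial := hmain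
    _ = ∑ t ∈ T, (kd t).factorial * (n - kd t).factorial :=
        Finset.sum_congr rfl fun t ht => by rw [(hIgood t ((hT t).1 ht)).1]
    _ ≤ ∑ t, (kd t).factorial * (n - kd t).factorial := Finset.sum_le_sum_of_subset (Finset.subset_univ _)

/-- The uniform case: `MixedLeftIdealLaw n ⇒ LeftIdealLaplaceRigidity n` (`w · k!(n-k)! ≥ n!`). -/
theorem leftIdeal_of_mixedLeftIdealLaw (n : ℕ) (h : MixedLeftIdealLaw n) : LeftIdealLaplaceRigidity n := by
  intro k w _ hkn p q hp hw hper
  have hcount : n.factorial ≤ w * (k.factorial * (n - k).factorial) := by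
    have h1 := h w (fun _ => k) p q hp hw hper
    rwa [Finset.sum_const, Finset.card_univ, Fintype.card_fin, smul_eq_mul] at h1
  have hpos : 0 < k.factorial * (n - k).factorial :=
    Nat.mul_pos (Nat.factorial_pos _) (Nat.factorial_pos _)
  have hchoose : n.choose k * (k.factorial * (n - k).factorial) = n.factorial := by
    rw [← mul_assoc]; exact Nat.choose_mul_factorial_mul_factorial hkn.le
  exact Nat.le_of_mul_le_mul_right (hchoose ▸ hcount) hpos

/-- **`LaplaceOptimal n ⇒ LeftIdealLaplaceRigidity n`.** -/
theorem leftIdeal_of_laplaceOptimal (n : ℕ) (hL : LaplaceOptimal n) : LeftIdealLaplaceRigidity n :=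
  leftIdeal_of_mixedLeftIdealLaw n (mixedLeftIdealLaw_of_laplaceOptimal n hL)

/-- Ideal phrasing: `per_n ∈ (p_0, …, p_{w-1})` with the `p_t` homogeneous degree-`k` row weight vectors ⇒ `w ≥ C(n,k)`. -/
theorem choose_le_of_perPoly_mem_span (hn : LeftIdealLaplaceRigidity n) {k w : ℕ} (hk : 0 < k) (hkn : k < n)
    (p : Fin w → MvPolynomial (Fin n × Fin n) ℂ) (hp : ∀ t, (p t).IsHomogeneous k)
    (hw : ∀ t, IsRowWeightVector (p t)) (hmem : perPoly (Fin n) ℂ ∈ Ideal.span (Set.range p)) :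
    n.choose k ≤ w := by
  obtain ⟨c, hc⟩ := Ideal.mem_span_range_iff_exists_fun.1 hmem
  exact hn k w hk hkn p c hp hw (by rw [← hc]; exact Finset.sum_congr rfl fun t _ => mul_comm _ _)

/-- The left-ideal law implies the left-torus-fixed law (drop the hypotheses on the cofactors). -/
theorem leftTorusFixed_of_leftIdeal (n : ℕ) (h : LeftIdealLaplaceRigidity n) : LeftTorusFixedLaplaceRigidity n :=
  fun k w hk hkn p q hp _ hd => h k w hk hkn p q hd.1 hp hd.2.2

/-- **val-idea-18's orphaned stub, now a theorem** (statement token-identical to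
`…Cruxes.CoverDecancellation.LeftTorusRung.stub_leftTorusFixed_of_laplaceOptimal`). -/
theorem stub_leftTorusFixed_of_laplaceOptimal (n : ℕ) (h : LaplaceOptimal n) :
    LeftTorusFixedLaplaceRigidity n :=
  leftTorusFixed_of_leftIdeal n (leftIdeal_of_laplaceOptimal n h)

/-! ### §2 Rungs: `n = 4` unconditional, `n = 5` by name -/

/-- `n = 4`, UNCONDITIONAL (from the landed `laplaceOptimal_four`, ✓ p597028). -/
theorem leftIdeal_four : LeftIdealLaplaceRigidity 4 := leftIdeal_of_laplaceOptimal 4 laplaceOptimal_four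

/-- `n = 4`, the left-torus form, UNCONDITIONAL. -/
theorem leftTorusFixed_four : LeftTorusFixedLaplaceRigidity 4 := leftTorusFixed_of_leftIdeal 4 leftIdeal_four

/-- **(4,2) left-ideal rung**: `per₄` is not of the form `∑_{i<5} p_i q_i` with the `p_i` row-equivariant quadrics. -/
def LeftIdealStrengthTwoPerFour : Prop :=
  ∀ p q : Fin 5 → MvPolynomial (Fin 4 × Fin 4) ℂ,
    (∀ i, (p i).IsHomogeneous 2) → (∀ i, IsRowWeightVector (p i)) → perPoly (Fin 4) ℂ ≠ ∑ i, p i * q i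

/-- … PROVED, unconditionally. -/
theorem leftIdealStrengthTwoPerFour : LeftIdealStrengthTwoPerFour := fun p q hp hw h =>
  absurd (leftIdeal_four 2 5 (by norm_num) (by norm_num) p q hp hw h) (by decide)

/-- … in ideal currency: `per₄ ∉ (p₁, …, p₅)` for any five row-equivariant quadrics (while `det₄ ∈ (u₁₂, u₁₃, u₁₄)`,
arXiv:2509.06294 Thm 3 — cited, not re-proved here). -/
theorem perFour_not_mem_span_five_rowEquivariant_quadrics (p : Fin 5 → MvPolynomial (Fin 4 × Fin 4) ℂ)
    (hp : ∀ i, (p i).IsHomogeneous 2) (hw : ∀ i, IsRowWeightVector (p i)) :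
    perPoly (Fin 4) ℂ ∉ Ideal.span (Set.range p) := fun hmem =>
  absurd (choose_le_of_perPoly_mem_span leftIdeal_four (by norm_num) (by norm_num) p hp hw hmem) (by decide)

/-- val-idea-18's `leftTorusFixedRungFourTwo` with its hypothesis `LaplaceOptimal 4` DISCHARGED: no row-homogeneous
(2,2)-decomposition of `per₄` of width 5. -/
theorem leftTorusFixedRungFourTwo :
    ∀ p q : Fin 5 → MvPolynomial (Fin 4 × Fin 4) ℂ,
      (∀ i, IsRowWeightVector (p i)) → (∀ i, IsRowWeightVector (q i)) → ¬ IsTwoFactorDecomp 4 2 5 p q :=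
  fun p q hp hq h => absurd (leftTorusFixed_four 2 5 (by norm_num) (by norm_num) p q hp hq h) (by decide)

/-- `n = 5` BY NAME from stmt-24813 (`Theses.RigidityForcesSymmetry.LaplaceOptimalFive ≝ LaplaceOptimal 5`): e.g.
`per₅ ∉` any ideal generated by 9 row-equivariant quadrics or by 9 row-equivariant cubics. -/
theorem leftIdeal_five
    (h5 : Summit.ValiantsHypothesis.ValiantsHypothesis.Theses.RigidityForcesSymmetry.LaplaceOptimalFive) :
    LeftIdealLaplaceRigidity 5 :=
  leftIdeal_of_laplaceOptimal 5 h5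

theorem leftIdealRungFiveTwo
    (h5 : Summit.ValiantsHypothesis.ValiantsHypothesis.Theses.RigidityForcesSymmetry.LaplaceOptimalFive) :
    ∀ p q : Fin 9 → MvPolynomial (Fin 5 × Fin 5) ℂ,
      (∀ i, (p i).IsHomogeneous 2) → (∀ i, IsRowWeightVector (p i)) → perPoly (Fin 5) ℂ ≠ ∑ i, p i * q i :=
  fun p q hp hw h => absurd (leftIdeal_five h5 2 9 (by norm_num) (by norm_num) p q hp hw h) (by decide)

theorem leftIdealRungFiveThree
    (h5 : Summit.ValiantsHypothesis.ValiantsHypothesis.Theses.RigidityForcesSymmetry.LaplaceOptimalFive) :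
    ∀ p q : Fin 9 → MvPolynomial (Fin 5 × Fin 5) ℂ,
      (∀ i, (p i).IsHomogeneous 3) → (∀ i, IsRowWeightVector (p i)) → perPoly (Fin 5) ℂ ≠ ∑ i, p i * q i :=
  fun p q hp hw h => absurd (leftIdeal_five h5 3 9 (by norm_num) (by norm_num) p q hp hw h) (by decide)

/-! ### §3 Placement below stmt-25160: `StrengthTwoPerFour ⇒ LeftIdealStrengthTwoPerFour`

A row-equivariant ideal membership `per₄ = ∑ p_i q_i` (cofactors arbitrary) homogenises to a (2,2)-decomposition
`per₄ = ∑ p_i (q_i)₂` of the same width, so the open rung `StrengthTwoPerFour` (no (2,2)-decomposition of width 5 at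
all) implies the left-ideal rung; the converse is the located gap (val-idea-18's `RowFaceDescent`). -/

/-- homogeneous component of a product with a homogeneous left factor. [bookkeeping] -/
private theorem homogeneousComponent_mul_left {σ : Type*} {k j : ℕ} {a : MvPolynomial σ ℂ} (ha : a.IsHomogeneous k)
    (b : MvPolynomial σ ℂ) : homogeneousComponent (k + j) (a * b) = a * homogeneousComponent j b := by
  classical
  conv_lhs => rw [← sum_homogeneousComponent b, Finset.mul_sum, map_sum]
  rw [Finset.sum_eq_single j]
  · rw [homogeneousComponent_of_mem
      ((mem_homogeneousSubmodule _ _).2 (ha.mul (homogeneousComponent_isHomogeneous j b))), if_pos rfl]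
  · intro i _ hij
    rw [homogeneousComponent_of_mem
      ((mem_homogeneousSubmodule _ _).2 (ha.mul (homogeneousComponent_isHomogeneous i b))), if_neg]
    omega
  · intro hj
    rw [Finset.mem_range, not_lt] at hj
    rw [homogeneousComponent_eq_zero j b (lt_of_lt_of_le (Nat.lt_succ_self _) hj), mul_zero, map_zero]

/-- `per₄` is its own degree-4 component. [bookkeeping] -/
private theorem homogeneousComponent_four_perPoly :
    homogeneousComponent 4 (perPoly (Fin 4) ℂ) = perPoly (Fin 4) ℂ := by
  have h : (perPoly (Fin 4) ℂ).IsHomogeneous (Fintype.card (Fin 4)) := perPoly_isHomogeneous (n := Fin 4) (k := ℂ)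
  rw [Fintype.card_fin] at h
  exact (homogeneousComponent_of_mem ((mem_homogeneousSubmodule _ _).2 h)).trans (if_pos rfl)

/-- **`StrengthTwoPerFour` (stmt-25160) ⇒ the (4,2) left-ideal rung.** -/
theorem leftIdealStrengthTwoPerFour_of_strengthTwoPerFour
    (h : Summit.ValiantsHypothesis.ValiantsHypothesis.Theses.PolyaContinued.StrengthTwoPerFour) :
    LeftIdealStrengthTwoPerFour := by
  intro p q hp _ hper
  refine h p (fun i => homogeneousComponent 2 (q i)) ⟨hp, fun i => homogeneousComponent_isHomogeneous 2 (q i), ?_⟩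
  have h4 := congrArg (homogeneousComponent 4) hper
  rw [homogeneousComponent_four_perPoly, map_sum] at h4
  rw [h4]
  exact Finset.sum_congr rfl fun i _ => homogeneousComponent_mul_left (j := 2) (hp i) (q i)

/-! ### §4 The converse dictionary: `MixedLeftIdealLaw n ⇒ LaplaceOptimal n` (so the two are EQUIVALENT)

From a split-rank-one decomposition `[v injective] = ∑_{t ∈ T} u_t(v|_{S_t}) · w_t(v|_{S_tᶜ})` of the permutation
pattern, LIFT each factor to a row-typed polynomial: `P_t := ∑_a u_t(a) · ∏_{i ∈ S_t} X_{i, a i}` over the functions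
`a` normalised to the identity off `S_t`, `Q_t := ∑_b w_t(b) · ∏_{i ∉ S_t} X_{i, b i}` likewise; then
`∑_t P_t Q_t = ∑_v [v injective] · m_v = per_n` (coefficientwise: graph monomials by one-sided unique factorisation,
all other monomials vanish on both sides), `P_t` is homogeneous of degree `|S_t|` and row-typed, and the mixed law
returns exactly the Laplace weight inequality. -/

/-- functions `Fin n → Fin n` normalised to the identity off `I`. -/
private def normSet (I : Finset (Fin n)) : Finset (Fin n → Fin n) :=
  Finset.univ.filter fun a => ∀ i, i ∉ I → a i = i

/-- normalisation of `v` to the identity off `I`. -/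
private def normTo (I : Finset (Fin n)) (v : Fin n → Fin n) : Fin n → Fin n :=
  fun i => if i ∈ I then v i else i

private theorem normTo_mem (I : Finset (Fin n)) (v : Fin n → Fin n) : normTo I v ∈ normSet I := by
  classical
  refine Finset.mem_filter.2 ⟨Finset.mem_univ _, fun i hi => ?_⟩
  simp [normTo, hi]

private theorem normTo_eq_on (I : Finset (Fin n)) (v : Fin n → Fin n) : ∀ i ∈ I, normTo I v i = v i :=
  fun i hi => by simp [normTo, hi]

/-- `graphMonomialOn I` remembers the values on `I`. [bookkeeping] -/
private theorem eq_on_of_graphMonomialOn_eq {I : Finset (Fin n)} {a b : Fin n → Fin n}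
    (h : graphMonomialOn I a = graphMonomialOn I b) : ∀ i ∈ I, a i = b i := by
  intro i hi
  have h1 := DFunLike.congr_fun h (i, a i)
  rw [graphMonomialOn_apply, graphMonomialOn_apply, if_pos ⟨hi, rfl⟩] at h1
  by_contra hne
  rw [if_neg fun h' => hne h'.2.symm] at h1
  exact one_ne_zero h1

/-- gluing two row parts on complementary rows gives a graph monomial. [bookkeeping] -/
private theorem graphMonomialOn_add_compl_glue (I : Finset (Fin n)) (a b : Fin n → Fin n) :
    graphMonomialOn I a + graphMonomialOn Iᶜ b = graphMonomial (fun i => if i ∈ I then a i else b i) := by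
  classical
  rw [graphMonomialOn_congr (τ := a) (τ' := fun i => if i ∈ I then a i else b i) (fun i hi => by simp [hi]),
    graphMonomialOn_congr (I := Iᶜ) (τ := b) (τ' := fun i => if i ∈ I then a i else b i)
      (fun i hi => by simp [Finset.mem_compl.1 hi]),
    graphMonomialOn_add_compl]

/-- row counts of a row part. [bookkeeping] -/
private theorem rowCount_graphMonomialOn (I : Finset (Fin n)) (τ : Fin n → Fin n) (i : Fin n) :
    rowCount (graphMonomialOn I τ) i = if i ∈ I then 1 else 0 := by
  classical
  unfold rowCount
  simp_rw [graphMonomialOn_apply]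
  by_cases hi : i ∈ I
  · rw [if_pos hi, Finset.sum_eq_single (τ i)]
    · rw [if_pos ⟨hi, rfl⟩]
    · intro c _ hc
      exact if_neg fun h => hc h.2.symm
    · intro h
      exact absurd (Finset.mem_univ _) h
  · rw [if_neg hi]
    exact Finset.sum_eq_zero fun c _ => if_neg fun h => hi h.1

/-- degree of a row part. [bookkeeping] -/
private theorem degree_graphMonomialOn (I : Finset (Fin n)) (τ : Fin n → Fin n) :
    (graphMonomialOn I τ).degree = I.card := by
  classical
  rw [degree_eq_sum_rowCount]
  simp_rw [rowCount_graphMonomialOn]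
  rw [Finset.sum_boole, Nat.cast_id]
  congr 1
  ext i
  simp

/-- **The lift** of a pattern factor `u` (a function of `v|_I`) to a row-typed polynomial:
`liftGen I u := ∑_{a normalised off I} u(a) · ∏_{i ∈ I} X_{i, a i}`. -/
def liftGen (I : Finset (Fin n)) (u : (Fin n → Fin n) → ℂ) : MvPolynomial (Fin n × Fin n) ℂ :=
  ∑ a ∈ normSet I, monomial (graphMonomialOn I a) (u a)

/-- support of the lift: row parts only. -/
private theorem exists_eq_of_coeff_liftGen_ne_zero {I : Finset (Fin n)} {u : (Fin n → Fin n) → ℂ}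
    {d : (Fin n × Fin n) →₀ ℕ} (h : coeff d (liftGen I u) ≠ 0) : ∃ a, d = graphMonomialOn I a := by
  classical
  by_contra hno
  apply h
  unfold liftGen
  rw [coeff_sum]
  exact Finset.sum_eq_zero fun a _ => by
    rw [coeff_monomial, if_neg fun h' => hno ⟨a, h'.symm⟩]

/-- coefficient of the lift at a row part: the (local) factor itself. -/
private theorem coeff_graphMonomialOn_liftGen {I : Finset (Fin n)} {u : (Fin n → Fin n) → ℂ}
    (hu : ∀ v v' : Fin n → Fin n, (∀ i ∈ I, v i = v' i) → u v = u v') (v : Fin n → Fin n) :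
    coeff (graphMonomialOn I v) (liftGen I u) = u v := by
  classical
  unfold liftGen
  rw [coeff_sum, Finset.sum_eq_single (normTo I v)]
  · rw [coeff_monomial, if_pos (graphMonomialOn_congr (normTo_eq_on I v))]
    exact hu _ _ (normTo_eq_on I v)
  · intro a ha hne
    rw [coeff_monomial, if_neg]
    intro h'
    apply hne
    funext i
    by_cases hi : i ∈ I
    · rw [eq_on_of_graphMonomialOn_eq h' i hi, normTo_eq_on I v i hi]
    · rw [(Finset.mem_filter.1 ha).2 i hi]
      simp [normTo, hi]
  · intro h
    exact absurd (normTo_mem I v) h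

/-- the lift is homogeneous of degree `|I|`. -/
theorem liftGen_isHomogeneous (I : Finset (Fin n)) (u : (Fin n → Fin n) → ℂ) :
    (liftGen I u).IsHomogeneous I.card := by
  unfold liftGen
  exact IsHomogeneous.sum _ _ _ fun a _ => isHomogeneous_monomial _ (degree_graphMonomialOn I a)

/-- the lift is row-typed by `I` … -/
theorem liftGen_isRowTyped (I : Finset (Fin n)) (u : (Fin n → Fin n) → ℂ) : IsRowTyped I (liftGen I u) :=
  fun d hd i => by
    obtain ⟨a, rfl⟩ := exists_eq_of_coeff_liftGen_ne_zero (mem_support_iff.1 hd)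
    exact rowCount_graphMonomialOn I a i

/-- … hence a row weight vector. -/
theorem liftGen_isRowWeightVector (I : Finset (Fin n)) (u : (Fin n → Fin n) → ℂ) :
    IsRowWeightVector (liftGen I u) := fun m hm m' hm' => by
  funext i
  show rowCount m i = rowCount m' i
  rw [liftGen_isRowTyped I u m hm i, liftGen_isRowTyped I u m' hm' i]

/-- **The lifted decomposition is an expression of `per_n`.** -/
theorem perPoly_eq_sum_liftGen {N : ℕ} (T : Finset (Fin N)) (S : Fin N → Finset (Fin n))
    (u w : Fin N → (Fin n → Fin n) → ℂ)
    (hu : ∀ t, ∀ v v' : Fin n → Fin n, (∀ i ∈ S t, v i = v' i) → u t v = u t v')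
    (hw : ∀ t, ∀ v v' : Fin n → Fin n, (∀ i, i ∉ S t → v i = v' i) → w t v = w t v')
    (hpat : ∀ v : Fin n → Fin n, (∑ t ∈ T, u t v * w t v) = if Function.Injective v then 1 else 0) :
    perPoly (Fin n) ℂ = ∑ t ∈ T, liftGen (S t) (u t) * liftGen (S t)ᶜ (w t) := by
  classical
  ext d
  rw [coeff_sum]
  by_cases hd : ∃ v, d = graphMonomial v
  · obtain ⟨v, rfl⟩ := hd
    rw [coeff_graphMonomial_perPoly_eq_injective, ← hpat v]
    refine Finset.sum_congr rfl fun t _ => ?_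
    have hw' : ∀ v v' : Fin n → Fin n, (∀ i ∈ (S t)ᶜ, v i = v' i) → w t v = w t v' :=
      fun v v' h => hw t v v' fun i hi => h i (Finset.mem_compl.2 hi)
    rw [coeff_graphMonomial_mul_of_isRowTyped (liftGen_isRowTyped (S t) (u t)),
      coeff_graphMonomialOn_liftGen (hu t), coeff_graphMonomialOn_liftGen hw']
  · -- a non-graph monomial occurs on neither side
    have hl : coeff d (perPoly (Fin n) ℂ) = 0 := by
      by_contra h
      obtain ⟨σ, hσ⟩ :=
        (Literature.Barriers.ValiantsHypothesis.JerrumSnir.mem_support_perPoly ℂ).1 (mem_support_iff.2 h)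
      exact hd ⟨⇑σ.symm, by rw [← hσ, permMonomial_eq_graphMonomial]⟩
    rw [hl, eq_comm]
    refine Finset.sum_eq_zero fun t _ => ?_
    rw [coeff_mul]
    refine Finset.sum_eq_zero fun ef hef => ?_
    by_contra hne
    obtain ⟨a, ha⟩ := exists_eq_of_coeff_liftGen_ne_zero (left_ne_zero_of_mul hne)
    obtain ⟨b, hb⟩ := exists_eq_of_coeff_liftGen_ne_zero (right_ne_zero_of_mul hne)
    have hsplit : ef.1 + ef.2 = d := Finset.HasAntidiagonal.mem_antidiagonal.1 hef
    rw [ha, hb, graphMonomialOn_add_compl_glue] at hsplit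
    exact hd ⟨_, hsplit.symm⟩

/-- **CONVERSE: `MixedLeftIdealLaw n ⇒ LaplaceOptimal n`.** -/
theorem laplaceOptimal_of_mixedLeftIdealLaw (n : ℕ) (hlaw : MixedLeftIdealLaw n) : LaplaceOptimal n := by
  classical
  intro N T S u w hu hw hpat
  have hper := perPoly_eq_sum_liftGen T S u w hu hw hpat
  -- reindex `T` by `Fin T.card`
  let e := T.equivFin
  let tj : Fin T.card → Fin N := fun j => (e.symm j).1
  have hre : ∀ {M : Type} [AddCommMonoid M] (f : Fin N → M), (∑ t ∈ T, f t) = ∑ j, f (tj j) := by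
    intro M _ f
    rw [← Finset.sum_coe_sort T f]
    exact (Equiv.sum_comp e.symm (fun x : ↥T => f x.1)).symm
  have h := hlaw T.card (fun j => (S (tj j)).card) (fun j => liftGen (S (tj j)) (u (tj j)))
    (fun j => liftGen (S (tj j))ᶜ (w (tj j))) (fun j => liftGen_isHomogeneous _ _)
    (fun j => liftGen_isRowWeightVector _ _)
    (by rw [hper]; exact hre (fun t => liftGen (S t) (u t) * liftGen (S t)ᶜ (w t)))
  calc n.factorial ≤ ∑ j, (S (tj j)).card.factorial * (n - (S (tj j)).card).factorial := h
    _ = ∑ t ∈ T, (S t).card.factorial * (n - (S t).card).factorial :=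
        (hre (fun t => (S t).card.factorial * (n - (S t).card).factorial)).symm

/-- **EQUIVALENCE**: Laplace optimality of the permutation pattern of order `n` (stmt-24813's object at `n = 5`) is
EXACTLY the mixed left-ideal law for `per_n`. -/
theorem laplaceOptimal_iff_mixedLeftIdealLaw (n : ℕ) : LaplaceOptimal n ↔ MixedLeftIdealLaw n :=
  ⟨mixedLeftIdealLaw_of_laplaceOptimal n, laplaceOptimal_of_mixedLeftIdealLaw n⟩

/-- `n = 4`: the mixed law, UNCONDITIONAL — e.g. `per₄ ∉ (ℓ₁, ℓ₂, ℓ₃, p)` for three row-linear forms and one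
row-equivariant quadric (`3·3!·1! + 2!·2! = 22 < 24`). -/
theorem mixedLeftIdealLaw_four : MixedLeftIdealLaw 4 := mixedLeftIdealLaw_of_laplaceOptimal 4 laplaceOptimal_four

/-- `n = 5`: `LaplaceOptimalFive` (stmt-24813) ⟺ the mixed left-ideal law for `per₅`. -/
theorem laplaceOptimalFive_iff_mixedLeftIdealLaw_five :
    Summit.ValiantsHypothesis.ValiantsHypothesis.Theses.RigidityForcesSymmetry.LaplaceOptimalFive ↔
      MixedLeftIdealLaw 5 :=
  laplaceOptimal_iff_mixedLeftIdealLaw 5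

end

end Summit.ValiantsHypothesis.ValiantsHypothesis.Cruxes.CoverDecancellation.LeftIdealRung
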